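import Literature.Algebra.EuclideanLattices.QaryBDDViaLLL
import Literature.Algebra.EuclideanLattices.RegevCoefficientBound

/-!
# Route `GreenTaoLevelTwo`, crux `GITwo` (stmt-Parity-21275), line `birth`, stub `stub_cyclicInverse`:
# coordinates with respect to an LLL-reduced basis (the geometry-of-numbers input of GT08a §10)

Fifty-sixth helper file toward the XL stub `stub_cyclicInverse` (B. Green, T. Tao, *An inverse
theorem for the Gowers `U³(G)` norm*, arXiv:math/0503014, Thm. 68 = PEMS 51 (2008) Thm. 12.8).
Block D14 (arXiv §10, "Bohr sets and generalized arithmetic progressions"): the passage from the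
Bohr set `B(S,ρ) ⊆ ℤ/Nℤ` to a proper generalized progression (arXiv Lemma 48 — a lattice basis
`w₁,…,w_d` with `|w₁|⋯|w_d| ≤ 2·d!·mes(ℝᵈ/Γ)`, Mahler + Minkowski II — and arXiv Lemma 49, the
"discrete John theorem", whose proof only uses the consequence `|lⱼ| ≤ C(d)|x|/|wⱼ|` for the
coordinates of `x = ∑ lⱼ wⱼ`, obtained there by Cramer's rule).  We take the reduced basis from
the LLL algorithm instead (the tree PROVES that every linearly independent integer family is
carried by LLL82's algorithm to an LLL-reduced family with the same `ℤ`-span: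
`exists_halted_int`, `isLLLReduced_lllResult_of_halted`, `span_range_comp_lllResult`,
`linearIndependent_lllResult` in `Literature/Algebra/EuclideanLattices/QaryBDDViaLLL.lean`), and
prove the coordinate bound for LLL-reduced families directly from the Gram–Schmidt picture
(LLL82 (1.4), (1.7); the downward induction of Regev 2004 Lemma 3.3,
`Regev2004.abs_coeff_le_two_pow_sq`, run with `‖x‖` in place of `‖b₀‖`):

* `abs_coeff_mul_norm_gramSchmidt_le` — for `b` linearly independent and LLL-reduced (`δ = 3/4`)
  and `x = ∑ uⱼ bⱼ` (`u ∈ ℝⁿ`): `|uᵢ| · ‖b*ᵢ‖ ≤ 2^{n(n+1)} ‖x‖`;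
* `abs_coeff_mul_norm_le` — hence `|uᵢ| · ‖bᵢ‖ ≤ 2^{n(n+2)} ‖x‖` (the form arXiv Lemma 49 uses);
* `exists_reduced_generators_int` — every linearly independent family `a₁,…,aₙ ∈ ℤᵐ` has a
  linearly independent family `w₁,…,wₙ ∈ ℤᵐ` with the same `ℤ`-span and this coordinate bound
  (arXiv Lemma 48 in the form §10 consumes it).

References: [GreenTao2008U3Inverse] arXiv:math/0503014, §10, Lemmas 48–49;
[LenstraLenstraLovasz1982] Prop. 1.6, 1.26; [Regev2004] Lemma 3.3 (method).
-/

noncomputable section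

namespace Summit.Parity.GeneralizedHardyLittlewood.GreenTaoLevelTwoGITwoCyclicInverse

open Finset Module InnerProductSpace Literature.Algebra.EuclideanLattices
open scoped RealInnerProductSpace

section Abstract

variable {E : Type*} [NormedAddCommGroup E] [InnerProductSpace ℝ E] {n : ℕ}

/-- For an LLL-reduced family (`δ = 3/4`), `‖b*ₖ‖ ≤ 2ⁿ ‖b*ⱼ‖` for `k ≤ j` (crude form of
LLL82 (1.7), Gram–Schmidt part `‖b*ₖ‖² ≤ 2^{j-k} ‖b*ⱼ‖²`).
[cite: LenstraLenstraLovasz1982, proof of Prop. 1.6] -/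
theorem norm_gramSchmidt_le_two_pow_mul {b : Fin n → E} (h : IsLLLReduced (3 / 4) b)
    {k j : Fin n} (hkj : k ≤ j) :
    ‖gramSchmidt ℝ b k‖ ≤ 2 ^ n * ‖gramSchmidt ℝ b j‖ := by
  have h1 : ‖gramSchmidt ℝ b k‖ ^ 2 ≤ 2 ^ ((j : ℕ) - k) * ‖gramSchmidt ℝ b j‖ ^ 2 :=
    IsLLLReduced.sq_norm_gramSchmidt_le_two_pow_mul_holds h hkj
  have h2 : (2 : ℝ) ^ ((j : ℕ) - k) ≤ (2 ^ n) ^ 2 := by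
    rw [← pow_mul]
    exact pow_le_pow_right₀ (by norm_num) (by omega)
  have h3 : ‖gramSchmidt ℝ b k‖ ^ 2 ≤ (2 ^ n * ‖gramSchmidt ℝ b j‖) ^ 2 := by
    rw [mul_pow]
    exact h1.trans (mul_le_mul_of_nonneg_right h2 (sq_nonneg _))
  exact (pow_le_pow_iff_left₀ (norm_nonneg _) (by positivity) two_ne_zero).1 h3

/-- For an LLL-reduced family (`δ = 3/4`), `‖bᵢ‖ ≤ 2ⁿ ‖b*ᵢ‖` (crude form of LLL82 (1.7),
`‖bᵢ‖² ≤ 2^i ‖b*ᵢ‖²`). [cite: LenstraLenstraLovasz1982, Prop. 1.6 (1.7)] -/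
theorem norm_le_two_pow_mul_norm_gramSchmidt {b : Fin n → E} (h : IsLLLReduced (3 / 4) b)
    (i : Fin n) : ‖b i‖ ≤ 2 ^ n * ‖gramSchmidt ℝ b i‖ := by
  have h1 : ‖b i‖ ^ 2 ≤ 2 ^ (i : ℕ) * ‖gramSchmidt ℝ b i‖ ^ 2 :=
    IsLLLReduced.sq_norm_le_two_pow_mul_self h i
  have h2 : (2 : ℝ) ^ (i : ℕ) ≤ (2 ^ n) ^ 2 := by
    rw [← pow_mul]
    exact pow_le_pow_right₀ (by norm_num) (by omega)
  have h3 : ‖b i‖ ^ 2 ≤ (2 ^ n * ‖gramSchmidt ℝ b i‖) ^ 2 := by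
    rw [mul_pow]
    exact h1.trans (mul_le_mul_of_nonneg_right h2 (sq_nonneg _))
  exact (pow_le_pow_iff_left₀ (norm_nonneg _) (by positivity) two_ne_zero).1 h3

/-- **Coordinates in an LLL-reduced basis, Gram–Schmidt form.**  Let `b₀,…,bₙ₋₁` be linearly
independent and LLL-reduced (`δ = 3/4`) in a real inner product space and `x = ∑ⱼ uⱼ bⱼ` with
real coefficients.  Then `|uᵢ| · ‖b*ᵢ‖ ≤ 2^{n(n+1)} ‖x‖` for every `i`.  (The `k`-th
Gram–Schmidt coordinate of `x` is `uₖ ‖b*ₖ‖ + ∑_{j>k} uⱼ ⟪bⱼ,b*ₖ⟫/‖b*ₖ‖`, of modulus `≤ ‖x‖`;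
with `|⟪bⱼ,b*ₖ⟫| ≤ ½‖b*ₖ‖²` and `‖b*ₖ‖ ≤ 2ⁿ‖b*ⱼ‖` this gives
`tₖ ≤ ‖x‖ + 2ⁿ ∑_{j>k} tⱼ` for `tⱼ = |uⱼ|‖b*ⱼ‖`, and a downward induction on suffix sums.)
[cite: GreenTao2008U3Inverse, §10 (proof of Lemma 49, the Cramer's-rule step)]
[cite: Regev2004, Lemma 3.3 (method)] -/
theorem abs_coeff_mul_norm_gramSchmidt_le {b : Fin n → E} (hb : LinearIndependent ℝ b)
    (h : IsLLLReduced (3 / 4) b) (u : Fin n → ℝ) (i : Fin n) :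
    |u i| * ‖gramSchmidt ℝ b i‖ ≤ 2 ^ (n * (n + 1)) * ‖∑ j, u j • b j‖ := by
  set x : E := ∑ j, u j • b j with hx
  -- `t j = |uⱼ| ‖b*ⱼ‖` extended by `0` to `ℕ`, and the suffix sums `R m = ∑_{m ≤ j < n} t j`
  set t : ℕ → ℝ := fun j => if hj : j < n then |u ⟨j, hj⟩| * ‖gramSchmidt ℝ b ⟨j, hj⟩‖ else 0
    with ht
  set R : ℕ → ℝ := fun m => ∑ j ∈ Ico m n, t j with hR
  have ht0 : ∀ j, 0 ≤ t j := fun j => by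
    simp only [ht]
    split_ifs
    · exact mul_nonneg (abs_nonneg _) (norm_nonneg _)
    · exact le_rfl
  have hR0 : ∀ m, 0 ≤ R m := fun m => sum_nonneg fun j _ => ht0 j
  have hRn : R n = 0 := by simp [hR]
  have hRsucc : ∀ k, k < n → R k = t k + R (k + 1) := fun k hk => sum_eq_sum_Ico_succ_bot hk t
  have hxn : 0 ≤ ‖x‖ := norm_nonneg _
  -- the key inequality `t k ≤ ‖x‖ + 2ⁿ R (k+1)`
  have key : ∀ k (hk : k < n), t k ≤ ‖x‖ + 2 ^ n * R (k + 1) := by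
    intro k hk
    set kk : Fin n := ⟨k, hk⟩ with hkk
    have hne : gramSchmidt ℝ b kk ≠ 0 := gramSchmidt_ne_zero kk hb
    have hgpos : 0 < ‖gramSchmidt ℝ b kk‖ := norm_pos_iff.2 hne
    have hsq : 0 < ‖gramSchmidt ℝ b kk‖ ^ 2 := pow_pos hgpos 2
    -- `c j = uⱼ ⟪bⱼ, b*_k⟫`, extended by `0`
    set c : ℕ → ℝ := fun j =>
      if hj : j < n then u ⟨j, hj⟩ * ⟪b ⟨j, hj⟩, gramSchmidt ℝ b kk⟫_ℝ else 0 with hc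
    have F1 : ⟪x, gramSchmidt ℝ b kk⟫_ℝ = ∑ j ∈ range n, c j := by
      rw [hx, sum_inner, ← Fin.sum_univ_eq_sum_range (fun j => c j) n]
      refine Finset.sum_congr rfl fun j _ => ?_
      rw [real_inner_smul_left]
      simp only [hc, dif_pos j.isLt, Fin.eta]
    have F3 : ∑ j ∈ Ico 0 k, c j = 0 := by
      refine Finset.sum_eq_zero fun j hj => ?_
      have hjk : j < k := (mem_Ico.1 hj).2
      have hjn : j < n := hjk.trans hk
      simp only [hc, dif_pos hjn]
      rw [real_inner_comm,
        gramSchmidt_inv_triangular ℝ b (show (⟨j, hjn⟩ : Fin n) < kk from hjk), mul_zero]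
    have F4 : c k = u kk * ‖gramSchmidt ℝ b kk‖ ^ 2 := by
      simp only [hc, dif_pos hk]
      rw [inner_self_gramSchmidt]
    have F2 : ∑ j ∈ range n, c j = u kk * ‖gramSchmidt ℝ b kk‖ ^ 2 + ∑ j ∈ Ico (k + 1) n, c j := by
      rw [range_eq_Ico, ← sum_Ico_consecutive c (Nat.zero_le k) hk.le, F3, zero_add,
        sum_eq_sum_Ico_succ_bot hk, F4]
    -- the tail: `|∑_{j>k} c j| ≤ ½ ‖b*_k‖ · 2ⁿ · R (k+1)`
    have F5 : |∑ j ∈ Ico (k + 1) n, c j| ≤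
        1 / 2 * ‖gramSchmidt ℝ b kk‖ * (2 ^ n * R (k + 1)) := by
      calc |∑ j ∈ Ico (k + 1) n, c j| ≤ ∑ j ∈ Ico (k + 1) n, |c j| := abs_sum_le_sum_abs _ _
        _ ≤ ∑ j ∈ Ico (k + 1) n, 1 / 2 * ‖gramSchmidt ℝ b kk‖ * (2 ^ n * t j) := by
            refine sum_le_sum fun j hj => ?_
            have hkj : k < j := (mem_Ico.1 hj).1
            have hjn : j < n := (mem_Ico.1 hj).2
            simp only [hc, ht, dif_pos hjn, abs_mul]
            have hin := abs_inner_gramSchmidt_le_half_sq_norm h (show kk < ⟨j, hjn⟩ from hkj)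
            have hgs := norm_gramSchmidt_le_two_pow_mul h (show kk ≤ ⟨j, hjn⟩ from hkj.le)
            calc |u ⟨j, hjn⟩| * |⟪b ⟨j, hjn⟩, gramSchmidt ℝ b kk⟫_ℝ|
                ≤ |u ⟨j, hjn⟩| * (1 / 2 * ‖gramSchmidt ℝ b kk‖ ^ 2) :=
                  mul_le_mul_of_nonneg_left hin (abs_nonneg _)
              _ = 1 / 2 * ‖gramSchmidt ℝ b kk‖ * (|u ⟨j, hjn⟩| * ‖gramSchmidt ℝ b kk‖) := by ring
              _ ≤ 1 / 2 * ‖gramSchmidt ℝ b kk‖ *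
                    (|u ⟨j, hjn⟩| * (2 ^ n * ‖gramSchmidt ℝ b ⟨j, hjn⟩‖)) :=
                  mul_le_mul_of_nonneg_left (mul_le_mul_of_nonneg_left hgs (abs_nonneg _))
                    (by positivity)
              _ = 1 / 2 * ‖gramSchmidt ℝ b kk‖ *
                    (2 ^ n * (|u ⟨j, hjn⟩| * ‖gramSchmidt ℝ b ⟨j, hjn⟩‖)) := by ring
        _ = 1 / 2 * ‖gramSchmidt ℝ b kk‖ * (2 ^ n * R (k + 1)) := by
            rw [hR, Finset.mul_sum, Finset.mul_sum]
    have F6 : |⟪x, gramSchmidt ℝ b kk⟫_ℝ| ≤ ‖x‖ * ‖gramSchmidt ℝ b kk‖ :=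
      abs_real_inner_le_norm _ _
    -- combine
    have hck : u kk * ‖gramSchmidt ℝ b kk‖ ^ 2 =
        ⟪x, gramSchmidt ℝ b kk⟫_ℝ - ∑ j ∈ Ico (k + 1) n, c j := by
      rw [F1, F2]; ring
    have habs : (|u kk| * ‖gramSchmidt ℝ b kk‖) * ‖gramSchmidt ℝ b kk‖ ≤
        (‖x‖ + 2 ^ n * R (k + 1)) * ‖gramSchmidt ℝ b kk‖ :=
      calc (|u kk| * ‖gramSchmidt ℝ b kk‖) * ‖gramSchmidt ℝ b kk‖
          = |u kk * ‖gramSchmidt ℝ b kk‖ ^ 2| := by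
            rw [abs_mul, abs_of_nonneg (sq_nonneg ‖gramSchmidt ℝ b kk‖)]; ring
        _ = |⟪x, gramSchmidt ℝ b kk⟫_ℝ - ∑ j ∈ Ico (k + 1) n, c j| := by rw [hck]
        _ ≤ |⟪x, gramSchmidt ℝ b kk⟫_ℝ| + |∑ j ∈ Ico (k + 1) n, c j| := abs_sub _ _
        _ ≤ ‖x‖ * ‖gramSchmidt ℝ b kk‖ +
              1 / 2 * ‖gramSchmidt ℝ b kk‖ * (2 ^ n * R (k + 1)) := add_le_add F6 F5
        _ ≤ ‖x‖ * ‖gramSchmidt ℝ b kk‖ + ‖gramSchmidt ℝ b kk‖ * (2 ^ n * R (k + 1)) := by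
            have : 0 ≤ ‖gramSchmidt ℝ b kk‖ * (2 ^ n * R (k + 1)) :=
              mul_nonneg (norm_nonneg _) (mul_nonneg (by positivity) (hR0 _))
            linarith
        _ = (‖x‖ + 2 ^ n * R (k + 1)) * ‖gramSchmidt ℝ b kk‖ := by ring
    have htk : t k = |u kk| * ‖gramSchmidt ℝ b kk‖ := by simp only [ht, dif_pos hk, hkk]
    rw [htk]
    exact le_of_mul_le_mul_right habs hgpos
  -- downward induction on the suffix sums: `R (n - d) ≤ (A^d - 1) ‖x‖`, `A = 2ⁿ + 1`
  set A : ℝ := 2 ^ n + 1 with hA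
  have hA2 : 2 ≤ A := by
    have : (1 : ℝ) ≤ 2 ^ n := one_le_pow₀ (by norm_num)
    rw [hA]; linarith
  have hind : ∀ d, d ≤ n → R (n - d) ≤ (A ^ d - 1) * ‖x‖ := by
    intro d
    induction d with
    | zero =>
      intro _
      simp [hRn]
    | succ d ih =>
      intro hd
      have hk : n - (d + 1) < n := by omega
      have hk1 : n - (d + 1) + 1 = n - d := by omega
      have h1 := hRsucc _ hk
      have h2 := key _ hk
      rw [hk1] at h1 h2
      have h3 := ih (by omega)
      have hAd : (1 : ℝ) ≤ A ^ d := one_le_pow₀ (by linarith)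
      -- `R(n-d-1) ≤ ‖x‖ + (2ⁿ + 1) R(n-d) ≤ ‖x‖ + A (A^d - 1) ‖x‖ ≤ (A^{d+1} - 1) ‖x‖`
      have h4 : R (n - (d + 1)) ≤ ‖x‖ + A * R (n - d) := by
        rw [h1, hA]
        nlinarith [hR0 (n - d)]
      have h5 : A * R (n - d) ≤ A * ((A ^ d - 1) * ‖x‖) :=
        mul_le_mul_of_nonneg_left h3 (by linarith)
      have h6 : ‖x‖ + A * ((A ^ d - 1) * ‖x‖) ≤ (A ^ (d + 1) - 1) * ‖x‖ := by
        rw [pow_succ]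
        nlinarith
      linarith
  -- conclusion for the index `i`
  have hi : (i : ℕ) < n := i.isLt
  have h1 : t i ≤ R i := by
    rw [hRsucc i hi]
    linarith [hR0 ((i : ℕ) + 1)]
  have h2 : R i ≤ (A ^ (n - i) - 1) * ‖x‖ := by
    have := hind (n - i) (Nat.sub_le _ _)
    rwa [Nat.sub_sub_self hi.le] at this
  have h3 : A ^ (n - (i : ℕ)) ≤ A ^ n := pow_le_pow_right₀ (by linarith) (Nat.sub_le _ _)
  have h4 : A ^ n ≤ 2 ^ (n * (n + 1)) := by
    have hA' : A ≤ 2 ^ (n + 1) := by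
      rw [hA, pow_succ]
      have : (1 : ℝ) ≤ 2 ^ n := one_le_pow₀ (by norm_num)
      linarith
    calc A ^ n ≤ (2 ^ (n + 1)) ^ n := pow_le_pow_left₀ (by linarith) hA' n
      _ = 2 ^ (n * (n + 1)) := by rw [← pow_mul, mul_comm]
  have hti : t i = |u i| * ‖gramSchmidt ℝ b i‖ := by simp only [ht, dif_pos hi, Fin.eta]
  rw [← hti]
  calc t i ≤ (A ^ (n - i) - 1) * ‖x‖ := h1.trans h2
    _ ≤ A ^ n * ‖x‖ := mul_le_mul_of_nonneg_right (by linarith) hxn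
    _ ≤ 2 ^ (n * (n + 1)) * ‖x‖ := mul_le_mul_of_nonneg_right h4 hxn

/-- **Coordinates in an LLL-reduced basis.**  Let `b₀,…,bₙ₋₁` be linearly independent and
LLL-reduced (`δ = 3/4`) and `x = ∑ⱼ uⱼ bⱼ` (`u ∈ ℝⁿ`).  Then `|uᵢ| · ‖bᵢ‖ ≤ 2^{n(n+2)} ‖x‖` for
every `i` — the property of the basis used in the proof of the discrete John theorem.
[cite: GreenTao2008U3Inverse, §10 (proof of Lemma 49)] -/
theorem abs_coeff_mul_norm_le {b : Fin n → E} (hb : LinearIndependent ℝ b)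
    (h : IsLLLReduced (3 / 4) b) (u : Fin n → ℝ) (i : Fin n) :
    |u i| * ‖b i‖ ≤ 2 ^ (n * (n + 2)) * ‖∑ j, u j • b j‖ := by
  have h1 := abs_coeff_mul_norm_gramSchmidt_le hb h u i
  have h2 := norm_le_two_pow_mul_norm_gramSchmidt h i
  have hpow : (2 : ℝ) ^ (n * (n + 2)) = 2 ^ n * 2 ^ (n * (n + 1)) := by
    rw [← pow_add]; congr 1; ring
  calc |u i| * ‖b i‖ ≤ |u i| * (2 ^ n * ‖gramSchmidt ℝ b i‖) :=
        mul_le_mul_of_nonneg_left h2 (abs_nonneg _)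
    _ = 2 ^ n * (|u i| * ‖gramSchmidt ℝ b i‖) := by ring
    _ ≤ 2 ^ n * (2 ^ (n * (n + 1)) * ‖∑ j, u j • b j‖) :=
        mul_le_mul_of_nonneg_left h1 (by positivity)
    _ = 2 ^ (n * (n + 2)) * ‖∑ j, u j • b j‖ := by rw [hpow]; ring

/-- In particular a vector of norm `< r` has small coordinates: `|uᵢ| · ‖bᵢ‖ < 2^{n(n+2)} r`.
[cite: GreenTao2008U3Inverse, §10 (proof of Lemma 49)] -/
theorem abs_coeff_mul_norm_lt_of_norm_lt {b : Fin n → E} (hb : LinearIndependent ℝ b)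
    (h : IsLLLReduced (3 / 4) b) (u : Fin n → ℝ) {r : ℝ} (hr : ‖∑ j, u j • b j‖ < r)
    (i : Fin n) : |u i| * ‖b i‖ < 2 ^ (n * (n + 2)) * r :=
  (abs_coeff_mul_norm_le hb h u i).trans_lt (mul_lt_mul_of_pos_left hr (by positivity))

end Abstract

/-! ### Reduced generators for integer lattices (arXiv Lemma 48, LLL form) -/

/-- **Reduced generators of an integer lattice.**  Every linearly independent family
`a₀,…,aₙ₋₁ ∈ ℤᵐ` (independent over `ℝ` in `ℝᵐ`) has a linearly independent family
`w₀,…,wₙ₋₁ ∈ ℤᵐ` with the same `ℤ`-span such that for all real `u` and all `i`,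
`|uᵢ| · ‖wᵢ‖ ≤ 2^{n(n+2)} ‖∑ⱼ uⱼ wⱼ‖` (Euclidean norms).  The `wⱼ` are the output of LLL82's
algorithm (`δ = 3/4`), which halts on integer input (tree: `exists_halted_int`,
`isLLLReduced_lllResult_of_halted`).  This replaces arXiv Lemma 48 (Mahler basis + Minkowski II)
in the proof of arXiv Lemma 49. [cite: GreenTao2008U3Inverse, §10, Lemmas 48–49]
[cite: LenstraLenstraLovasz1982, Prop. 1.26] -/
theorem exists_reduced_generators_int {n m : ℕ} (a : Fin n → (Fin m → ℤ))
    (hli : LinearIndependent ℝ (⇑(intVecToEuclidean m) ∘ a)) :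
    ∃ w : Fin n → (Fin m → ℤ), LinearIndependent ℝ (⇑(intVecToEuclidean m) ∘ w) ∧
      Submodule.span ℤ (Set.range w) = Submodule.span ℤ (Set.range a) ∧
      ∀ (u : Fin n → ℝ) (i : Fin n),
        |u i| * ‖intVecToEuclidean m (w i)‖ ≤
          2 ^ (n * (n + 2)) * ‖∑ j, u j • intVecToEuclidean m (w j)‖ := by
  set φ := (intVecToEuclidean m).toAddMonoidHom with hφ
  have hφa : (⇑φ ∘ a) = (⇑(intVecToEuclidean m) ∘ a) := rfl
  have hhalt := exists_halted_int a hli (δ := 3 / 4) (by norm_num) (by norm_num)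
  set w := lllResult φ (3 / 4) a with hw
  have hred : IsLLLReduced (3 / 4) (⇑φ ∘ w) := isLLLReduced_lllResult_of_halted φ a hhalt
  have hliw : LinearIndependent ℝ (⇑φ ∘ w) := linearIndependent_lllResult φ (3 / 4) a hli
  refine ⟨w, hliw, lllResult_span_eq φ (3 / 4) a, fun u i => ?_⟩
  have := abs_coeff_mul_norm_le hliw hred u i
  simpa [hφ] using this

end Summit.Parity.GeneralizedHardyLittlewood.GreenTaoLevelTwoGITwoCyclicInverse
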